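import Mathlib.GroupTheory.Nilpotent
import Mathlib.GroupTheory.QuotientGroup.Basic
import Mathlib.GroupTheory.FreeGroup.Basic
import Mathlib.Algebra.BigOperators.Group.List.Basic
import Literature.Topology.FourManifolds.GroupTrisections
import HarnessLib
import Summits.SmoothPoincare4.SmoothPoincare4.Theorems.CongruenceShadowsNilpotentShadowsStandardGlueNilpotentBasis
import Summits.SmoothPoincare4.SmoothPoincare4.Theorems.CongruenceShadowsNilpotentShadowsStandardGlueCutDictionary

/-!
# Level-one glue III: reading the level-one data of an honest kernel
# (helper for stub `stub_levelOneGlue`)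

Line `saturated-torsor-descent`, crux `CongruenceShadows.NilpotentShadowsStandard`
(item stmt-SmoothPoincare4-14594).  `S = S_g`, `F = FreeGroup (Fin g)`, a cut pattern
`ct : Fin g → Bool` with erasing projection `π : S ↠ F` (cut letters `x_h = (h, ct h) ↦ 1`,
survivors `y_h = (h, !ct h) ↦ of h`), signs `s_h = if ct h then -1 else 1`, and an HONEST kernel
`Q ◁ S` (`S ⧸ Q ≅ F`, realised by a surjection `ρ : S ↠ F` with kernel `Q`) whose abelian shadow
is that of `ker π` (`Q ≤ ker π · γ₂ S`), with corrections `u_h ∈ γ₂ S`, `u_h x_h ∈ Q`.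
* `exists_base_correction` + the nilpotent basis correction (Glue I) turn `ρ` into
  `ρ' : S → F` killing `Q` with `ρ' y_h ≡ of h (mod γ₄ F)`; then `η_h = ρ' u_h ∈ γ₂ F`,
  `ρ' x_h = η_h⁻¹`, and the surface relation reads `∏_h ⁅η_h⁻¹, of h⁆ ^ s_h ∈ γ₄ F`;
* the READING hypothesis (the landed `stub_magnusWittRead`, taken as a hypothesis) produces an
  alternating `D` with `η_h ≡ PP(s_h • D h) (mod γ₃ F)`, and two homomorphisms `S → F ⧸ γ₃ F`
  agreeing on survivors and central on cut letters agree on `γ₂ S`, whence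
  `π u_h ≡ PP(s_h • D h) (mod γ₃ F)` (`reading`, registered as `helper_glueReading`);
* `reading_compat`: for two cut patterns and a pair kernel without hidden depth the two forms
  agree on common handles (degree-2 injectivity `INJ2`, also a hypothesis).
No definitions.
-/

set_option linter.dupNamespace false

open Subgroup Literature.Topology.FourManifolds
open scoped commutatorElement

namespace Summit.SmoothPoincare4.SmoothPoincare4.Theorems.NilpotentShadowsStandard.SaturatedTorsorDescent

section PairProducts

variable {G : Type*} [Group G] {n : ℕ}

/-- Commutators of `F ⧸ γ₃ F`-type quotients: in `G ⧸ γ₃ G` every commutator is central.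
[folklore] -/
theorem quot_commutator_mem_center (a b : G ⧸ (⊤ : Subgroup G).lowerCentralSeries 2) :
    ⁅a, b⁆ ∈ center (G ⧸ (⊤ : Subgroup G).lowerCentralSeries 2) := by
  obtain ⟨a, rfl⟩ := QuotientGroup.mk_surjective a
  obtain ⟨b, rfl⟩ := QuotientGroup.mk_surjective b
  change ⁅QuotientGroup.mk' _ a, QuotientGroup.mk' _ b⁆ ∈ _
  rw [← map_commutatorElement, QuotientGroup.mk'_apply]
  exact mk_lcs_mem_center (commutator_mem_commutator (mem_top a) (mem_top b))

/-- **Difference of pair products.** If two pair products of generator commutators agree modulo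
`γ₃`, the pair product of the difference of the exponents lies in `γ₃`. [folklore] -/
theorem pp_sub_mem (c : Fin n → Fin n → G) (hc : ∀ v w, ∃ a b : G, c v w = ⁅a, b⁆)
    (e e' : Fin n → Fin n → ℤ)
    (h : QuotientGroup.mk' ((⊤ : Subgroup G).lowerCentralSeries 2)
        ((List.finRange n).map (fun v => ((List.finRange n).map (fun w =>
          if v < w then c v w ^ (e v w) else 1)).prod)).prod =
      QuotientGroup.mk' ((⊤ : Subgroup G).lowerCentralSeries 2)
        ((List.finRange n).map (fun v => ((List.finRange n).map (fun w =>
          if v < w then c v w ^ (e' v w) else 1)).prod)).prod) :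
    ((List.finRange n).map (fun v => ((List.finRange n).map (fun w =>
      if v < w then c v w ^ (e v w - e' v w) else 1)).prod)).prod ∈
      (⊤ : Subgroup G).lowerCentralSeries 2 := by
  set N := (⊤ : Subgroup G).lowerCentralSeries 2
  have hc' : ∀ v w, (QuotientGroup.mk' N) (c v w) ∈ center (G ⧸ N) := fun v w => by
    obtain ⟨a, b, hab⟩ := hc v w
    rw [hab, map_commutatorElement]
    exact quot_commutator_mem_center _ _
  rw [← QuotientGroup.ker_mk' N, MonoidHom.mem_ker, pp_map]
  rw [pp_map, pp_map] at h
  have h2 := pp_add (fun v w => (QuotientGroup.mk' N) (c v w)) hc' (fun v w => e v w - e' v w) e'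
  simp only [sub_add_cancel] at h2
  rw [h] at h2
  exact mul_eq_right.1 h2.symm

end PairProducts

section Reading

variable {g : ℕ}

/-- **Base correction.** If `ρ : S ↠ F` has kernel `Q ≤ ker π · γ₂ S` for the erasing projection
`π` of a cut pattern, some endomorphism `β₀` of `F` has `β₀ (ρ y_h) ≡ of h (mod γ₂ F)` on the
survivors. [folklore] -/
theorem exists_base_correction (ct : Fin g → Bool) (π : SurfaceGroup g →* FreeGroup (Fin g))
    (hπ : ∀ (h : Fin g) (b : Bool), π (PresentedGroup.of (h, b)) = if b = ct h then 1 else FreeGroup.of h)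
    (Q : Subgroup (SurfaceGroup g)) (ρ : SurfaceGroup g →* FreeGroup (Fin g))
    (hρ : Function.Surjective ρ) (hρQ : ρ.ker = Q)
    (hQ : Q ≤ π.ker ⊔ (⊤ : Subgroup (SurfaceGroup g)).lowerCentralSeries 1) :
    ∃ β₀ : FreeGroup (Fin g) →* FreeGroup (Fin g), ∀ h : Fin g,
      β₀ (ρ (PresentedGroup.of (h, !ct h))) * (FreeGroup.of h)⁻¹ ∈
        (⊤ : Subgroup (FreeGroup (Fin g))).lowerCentralSeries 1 := by
  set P₁ := (QuotientGroup.mk' ((⊤ : Subgroup (FreeGroup (Fin g))).lowerCentralSeries 1)).comp ρ with hP₁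
  set P₂ := (QuotientGroup.mk' ((⊤ : Subgroup (FreeGroup (Fin g))).lowerCentralSeries 1)).comp π with hP₂
  have hP₁s : Function.Surjective P₁ := (QuotientGroup.mk'_surjective _).comp hρ
  have hker : P₁.ker ≤ P₂.ker := by
    intro s hs
    rw [MonoidHom.mem_ker, hP₁, MonoidHom.comp_apply, ← MonoidHom.mem_ker, QuotientGroup.ker_mk',
      ← map_lcs_eq_of_surjective ρ hρ 1] at hs
    obtain ⟨t, ht, hts⟩ := hs
    have h1 : s * t⁻¹ ∈ Q := by
      rw [← hρQ, MonoidHom.mem_ker, map_mul, map_inv, hts, mul_inv_cancel]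
    have h2 : s ∈ π.ker ⊔ (⊤ : Subgroup (SurfaceGroup g)).lowerCentralSeries 1 := by
      rw [← inv_mul_cancel_right s t]
      exact mul_mem (hQ h1) (mem_sup_right ht)
    obtain ⟨a, ha, z, hz, rfl⟩ := mem_sup_of_normal_right.1 h2
    rw [MonoidHom.mem_ker, hP₂, MonoidHom.comp_apply, map_mul, (MonoidHom.mem_ker).1 ha, one_mul,
      ← MonoidHom.mem_ker, QuotientGroup.ker_mk']
    exact map_lcs_mem π hz
  set ψ := P₁.liftOfSurjective hP₁s ⟨P₂, hker⟩ with hψ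
  have hψP : ∀ s, ψ (P₁ s) = P₂ s := fun s => P₁.liftOfRightInverse_comp_apply _ _ ⟨P₂, hker⟩ s
  set β₀ : FreeGroup (Fin g) →* FreeGroup (Fin g) :=
    FreeGroup.lift fun h => Quotient.out (ψ (QuotientGroup.mk (FreeGroup.of h))) with hβ₀
  have hβ₀' : (QuotientGroup.mk' ((⊤ : Subgroup (FreeGroup (Fin g))).lowerCentralSeries 1)).comp β₀ =
      ψ.comp (QuotientGroup.mk' _) := by
    refine FreeGroup.ext_hom _ _ fun h => ?_
    rw [MonoidHom.comp_apply, MonoidHom.comp_apply, hβ₀, FreeGroup.lift_apply_of,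
      QuotientGroup.mk'_apply, QuotientGroup.mk'_apply, QuotientGroup.out_eq']
  refine ⟨β₀, fun h => ?_⟩
  rw [mul_inv_mem_iff_quot]
  have e1 := DFunLike.congr_fun hβ₀' (ρ (PresentedGroup.of (h, !ct h)))
  simp only [MonoidHom.comp_apply, QuotientGroup.mk'_apply] at e1
  rw [e1, show (ρ (PresentedGroup.of (h, !ct h)) : FreeGroup (Fin g) ⧸
      (⊤ : Subgroup (FreeGroup (Fin g))).lowerCentralSeries 1) = P₁ (PresentedGroup.of (h, !ct h))
    from rfl, hψP, hP₂, MonoidHom.comp_apply, hπ, if_neg (by cases ct h <;> decide)]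
  rfl

/-- Two homomorphisms out of `S_g` agreeing modulo the centre on the letters agree modulo the
centre everywhere. [folklore] -/
theorem central_of_letters {M : Type*} [Group M] (A B : SurfaceGroup g →* M)
    (h : ∀ x : Fin g × Bool, A (PresentedGroup.of x) * (B (PresentedGroup.of x))⁻¹ ∈ center M)
    (s : SurfaceGroup g) : A s * (B s)⁻¹ ∈ center M := by
  have e : (QuotientGroup.mk' (center M)).comp A = (QuotientGroup.mk' (center M)).comp B :=
    PresentedGroup.ext fun x => by
      simpa only [MonoidHom.comp_apply, QuotientGroup.mk'_apply, mul_inv_mem_iff_quot] using h x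
  have := DFunLike.congr_fun e s
  simpa only [MonoidHom.comp_apply, QuotientGroup.mk'_apply, mul_inv_mem_iff_quot] using this

/-- **Reading the level-one data of an honest kernel** (see the module docstring): granted the
READING lemma for free groups, the corrections `u_h` of an honest kernel `Q` read, through the
erasing projection, as pair products `π u_h ≡ ∏_{v<w} ⁅of v, of w⁆ ^ (s_h D h v w) (mod γ₃ F)`
for an alternating integer form `D`. [folklore] -/
theorem reading
    (hREAD : ∀ (n : ℕ) (s : Fin n → ℤ) (η : Fin n → FreeGroup (Fin n)), (∀ j, s j = 1 ∨ s j = -1) →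
      (∀ j, η j ∈ (⊤ : Subgroup (FreeGroup (Fin n))).lowerCentralSeries 1) →
      ((List.finRange n).map (fun j => ⁅(η j)⁻¹, FreeGroup.of j⁆ ^ (s j))).prod ∈
        (⊤ : Subgroup (FreeGroup (Fin n))).lowerCentralSeries 3 →
      ∃ D : Fin n → Fin n → Fin n → ℤ, (∀ a b c, D b a c = -D a b c) ∧ (∀ a b c, D a c b = -D a b c) ∧
        ∀ j, η j * (((List.finRange n).map (fun v => ((List.finRange n).map (fun w =>
          if v < w then ⁅(FreeGroup.of v : FreeGroup (Fin n)), FreeGroup.of w⁆ ^ (s j * D j v w)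
          else (1 : FreeGroup (Fin n)))).prod)).prod)⁻¹ ∈
          (⊤ : Subgroup (FreeGroup (Fin n))).lowerCentralSeries 2)
    (ct : Fin g → Bool) (π : SurfaceGroup g →* FreeGroup (Fin g))
    (hπ : ∀ (h : Fin g) (b : Bool), π (PresentedGroup.of (h, b)) = if b = ct h then 1 else FreeGroup.of h)
    (Q : Subgroup (SurfaceGroup g)) (ρ : SurfaceGroup g →* FreeGroup (Fin g))
    (hρ : Function.Surjective ρ) (hρQ : ρ.ker = Q)
    (hQ : Q ≤ π.ker ⊔ (⊤ : Subgroup (SurfaceGroup g)).lowerCentralSeries 1)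
    (u : Fin g → SurfaceGroup g) (hu₁ : ∀ h, u h ∈ (⊤ : Subgroup (SurfaceGroup g)).lowerCentralSeries 1)
    (hu₂ : ∀ h, u h * PresentedGroup.of (h, ct h) ∈ Q) :
    ∃ D : Fin g → Fin g → Fin g → ℤ, (∀ a b c, D b a c = -D a b c) ∧ (∀ a b c, D a c b = -D a b c) ∧
      ∀ j, π (u j) * (((List.finRange g).map (fun v => ((List.finRange g).map (fun w =>
        if v < w then ⁅(FreeGroup.of v : FreeGroup (Fin g)), FreeGroup.of w⁆ ^
          ((if ct j then (-1 : ℤ) else 1) * D j v w) else (1 : FreeGroup (Fin g)))).prod)).prod)⁻¹ ∈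
        (⊤ : Subgroup (FreeGroup (Fin g))).lowerCentralSeries 2 := by
  -- the corrected comparison map `ρ' : S → F`
  obtain ⟨β₀, hβ₀⟩ := exists_base_correction ct π hπ Q ρ hρ hρQ hQ
  obtain ⟨β, hβ⟩ := freeGroup_basis_correction (fun h => β₀ (ρ (PresentedGroup.of (h, !ct h)))) hβ₀
  obtain ⟨ρ', hρ'y, hρ'Q⟩ : ∃ ρ' : SurfaceGroup g →* FreeGroup (Fin g),
      (∀ h, ρ' (PresentedGroup.of (h, !ct h)) * (FreeGroup.of h)⁻¹ ∈
        (⊤ : Subgroup (FreeGroup (Fin g))).lowerCentralSeries 3) ∧ ∀ q ∈ Q, ρ' q = 1 := by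
    refine ⟨β.comp (β₀.comp ρ), hβ, fun q hq => ?_⟩
    rw [← hρQ] at hq
    rw [MonoidHom.comp_apply, MonoidHom.comp_apply, (MonoidHom.mem_ker).1 hq, map_one, map_one]
  set η : Fin g → FreeGroup (Fin g) := fun h => ρ' (u h) with hη
  have hη₂ : ∀ h, η h ∈ (⊤ : Subgroup (FreeGroup (Fin g))).lowerCentralSeries 1 :=
    fun h => map_lcs_mem ρ' (hu₁ h)
  have hρ'x : ∀ h, ρ' (PresentedGroup.of (h, ct h)) = (η h)⁻¹ := fun h =>
    eq_inv_of_mul_eq_one_right (by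
      show ρ' (u h) * ρ' (PresentedGroup.of (h, ct h)) = 1
      rw [← map_mul]
      exact hρ'Q _ (hu₂ h))
  set s : Fin g → ℤ := fun h => if ct h then (-1 : ℤ) else 1 with hs
  have hs1 : ∀ j, s j = 1 ∨ s j = -1 := fun j => by
    simp only [hs]; split_ifs <;> simp
  -- the surface relation read in `F ⧸ γ₄ F`
  have hrel4 : ((List.finRange g).map (fun j => ⁅(η j)⁻¹, FreeGroup.of j⁆ ^ (s j))).prod ∈
      (⊤ : Subgroup (FreeGroup (Fin g))).lowerCentralSeries 3 := by
    have hrel := prod_handle_commutators_eq_one ct ρ'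
    rw [← QuotientGroup.ker_mk' ((⊤ : Subgroup (FreeGroup (Fin g))).lowerCentralSeries 3),
      MonoidHom.mem_ker, map_list_prod, List.map_map]
    rw [← (QuotientGroup.mk' ((⊤ : Subgroup (FreeGroup (Fin g))).lowerCentralSeries 3)).map_one,
      ← hrel, map_list_prod, List.map_map]
    refine congrArg List.prod (List.map_congr_left fun h _ => ?_)
    show QuotientGroup.mk' _ (⁅(η h)⁻¹, FreeGroup.of h⁆ ^ s h) =
      QuotientGroup.mk' _ (⁅ρ' (PresentedGroup.of (h, ct h)), ρ' (PresentedGroup.of (h, !ct h))⁆ ^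
        (if ct h then (-1 : ℤ) else 1))
    rw [map_zpow, map_zpow, map_commutatorElement, map_commutatorElement, hρ'x,
      QuotientGroup.mk'_apply, QuotientGroup.mk'_apply, QuotientGroup.mk'_apply,
      (mul_inv_mem_iff_quot _ _ _).1 (hρ'y h)]
  obtain ⟨D, hD1, hD2, hD3⟩ := hREAD g s η hs1 hη₂ hrel4
  refine ⟨D, hD1, hD2, fun j => ?_⟩
  -- transport from `ρ'` to `π`: the two agree modulo the centre of `F ⧸ γ₃ F`
  set Γ₃ := (⊤ : Subgroup (FreeGroup (Fin g))).lowerCentralSeries 2 with hΓ₃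
  have hcen : ∀ x : Fin g × Bool, (QuotientGroup.mk' Γ₃).comp ρ' (PresentedGroup.of x) *
      ((QuotientGroup.mk' Γ₃).comp π (PresentedGroup.of x))⁻¹ ∈ center (FreeGroup (Fin g) ⧸ Γ₃) := by
    rintro ⟨h, b⟩
    rw [MonoidHom.comp_apply, MonoidHom.comp_apply, QuotientGroup.mk'_apply, QuotientGroup.mk'_apply, hπ]
    by_cases hb : b = ct h
    · rw [if_pos hb, hb, hρ'x, QuotientGroup.mk_one, inv_one, mul_one, QuotientGroup.mk_inv]
      exact inv_mem (mk_lcs_mem_center (hη₂ h))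
    · have hb' : b = !ct h := by revert hb; cases b <;> cases ct h <;> decide
      rw [if_neg hb, hb', ← QuotientGroup.mk_inv, ← QuotientGroup.mk_mul,
        (QuotientGroup.eq_one_iff _).2 (lcs_antitone (by decide) (hρ'y h))]
      exact one_mem _
  have key := eqOn_lcs_one_of_central ((QuotientGroup.mk' Γ₃).comp ρ') ((QuotientGroup.mk' Γ₃).comp π)
    (central_of_letters _ _ hcen) (hu₁ j)
  simp only [MonoidHom.comp_apply, QuotientGroup.mk'_apply] at key
  have key' : π (u j) * (η j)⁻¹ ∈ Γ₃ := by
    rw [mul_inv_mem_iff_quot]; exact key.symm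
  have e : ∀ a b c : FreeGroup (Fin g), a * c⁻¹ = (a * b⁻¹) * (b * c⁻¹) := fun a b c => by group
  rw [e (π (u j)) (η j)]
  exact mul_mem key' (hD3 j)

/-! ## Compatibility of the readings on a pair of cut patterns -/

/-- Killing the non-common survivors after either erasing projection gives the same map.
[folklore] -/
theorem comp_erase_eq (cti ctk : Fin g → Bool) (πi πk : SurfaceGroup g →* FreeGroup (Fin g))
    (hπi : ∀ (h : Fin g) (b : Bool), πi (PresentedGroup.of (h, b)) = if b = cti h then 1 else FreeGroup.of h)
    (hπk : ∀ (h : Fin g) (b : Bool), πk (PresentedGroup.of (h, b)) = if b = ctk h then 1 else FreeGroup.of h) :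
    (FreeGroup.lift fun h => if cti h = ctk h then FreeGroup.of h else (1 : FreeGroup (Fin g))).comp πi =
      (FreeGroup.lift fun h => if cti h = ctk h then FreeGroup.of h else (1 : FreeGroup (Fin g))).comp πk := by
  refine PresentedGroup.ext fun x => ?_
  obtain ⟨h, b⟩ := x
  simp only [MonoidHom.comp_apply, hπi, hπk]
  by_cases hik : cti h = ctk h
  · rw [hik]
  · have h1 : (FreeGroup.lift fun h => if cti h = ctk h then FreeGroup.of h else (1 : FreeGroup (Fin g)))
        (FreeGroup.of h) = 1 := by rw [FreeGroup.lift_apply_of, if_neg hik]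
    split_ifs <;> simp only [map_one, h1]

/-- **Compatibility of readings.** For two cut patterns `cti`, `ctk` with erasing projections
`πi`, `πk`, a normal `Q` without hidden depth contained in `(ker πi ⊔ ker πk) γ₂`, and corrections
`ui`, `uk` of `Q` read (modulo `⁅ker π, S⁆ γ₃`, through `πi`, `πk`) by alternating forms `Di`, `Dk`:
granted degree-2 injectivity `INJ2`, the forms agree on common handles. [folklore] -/
theorem reading_compat
    (hINJ : ∀ (n : ℕ) (e : Fin n → Fin n → ℤ), ((List.finRange n).map (fun v => ((List.finRange n).map
      (fun w => if v < w then ⁅(FreeGroup.of v : FreeGroup (Fin n)), FreeGroup.of w⁆ ^ (e v w)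
        else (1 : FreeGroup (Fin n)))).prod)).prod ∈ (⊤ : Subgroup (FreeGroup (Fin n))).lowerCentralSeries 2 →
      ∀ v w : Fin n, v < w → e v w = 0)
    (cti ctk : Fin g → Bool) (πi πk : SurfaceGroup g →* FreeGroup (Fin g))
    (hπi : ∀ (h : Fin g) (b : Bool), πi (PresentedGroup.of (h, b)) = if b = cti h then 1 else FreeGroup.of h)
    (hπk : ∀ (h : Fin g) (b : Bool), πk (PresentedGroup.of (h, b)) = if b = ctk h then 1 else FreeGroup.of h)
    (Q : Subgroup (SurfaceGroup g)) [Q.Normal]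
    (hQ : Q ⊓ (⊤ : Subgroup (SurfaceGroup g)).lowerCentralSeries 1 ≤ ⁅Q, (⊤ : Subgroup (SurfaceGroup g))⁆)
    (hQle : Q ≤ (πi.ker ⊔ πk.ker) ⊔ (⊤ : Subgroup (SurfaceGroup g)).lowerCentralSeries 1)
    (ui uk : Fin g → SurfaceGroup g)
    (hui₁ : ∀ h, ui h ∈ (⊤ : Subgroup (SurfaceGroup g)).lowerCentralSeries 1)
    (huk₁ : ∀ h, uk h ∈ (⊤ : Subgroup (SurfaceGroup g)).lowerCentralSeries 1)
    (hui₂ : ∀ h, ui h * PresentedGroup.of (h, cti h) ∈ Q)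
    (huk₂ : ∀ h, uk h * PresentedGroup.of (h, ctk h) ∈ Q)
    (Di Dk : Fin g → Fin g → Fin g → ℤ)
    (hDi2 : ∀ a b c, Di a c b = -Di a b c) (hDk2 : ∀ a b c, Dk a c b = -Dk a b c)
    (hDi : ∀ j, πi (ui j) * (((List.finRange g).map (fun v => ((List.finRange g).map (fun w =>
        if v < w then ⁅(FreeGroup.of v : FreeGroup (Fin g)), FreeGroup.of w⁆ ^
          ((if cti j then (-1 : ℤ) else 1) * Di j v w) else (1 : FreeGroup (Fin g)))).prod)).prod)⁻¹ ∈
        (⊤ : Subgroup (FreeGroup (Fin g))).lowerCentralSeries 2)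
    (hDk : ∀ j, πk (uk j) * (((List.finRange g).map (fun v => ((List.finRange g).map (fun w =>
        if v < w then ⁅(FreeGroup.of v : FreeGroup (Fin g)), FreeGroup.of w⁆ ^
          ((if ctk j then (-1 : ℤ) else 1) * Dk j v w) else (1 : FreeGroup (Fin g)))).prod)).prod)⁻¹ ∈
        (⊤ : Subgroup (FreeGroup (Fin g))).lowerCentralSeries 2)
    (j v w : Fin g) (hj : cti j = ctk j) (hv : cti v = ctk v) (hw : cti w = ctk w) :
    Di j v w = Dk j v w := by
  set Γ₃ := (⊤ : Subgroup (FreeGroup (Fin g))).lowerCentralSeries 2 with hΓ₃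
  set δ : FreeGroup (Fin g) →* FreeGroup (Fin g) :=
    FreeGroup.lift fun h => if cti h = ctk h then FreeGroup.of h else (1 : FreeGroup (Fin g)) with hδ
  have hδπ : δ.comp πi = δ.comp πk := comp_erase_eq cti ctk πi πk hπi hπk
  -- the difference of the two corrections at the common cut letter dies under `δ ∘ π` modulo `γ₃`
  have hd : ui j * (uk j)⁻¹ ∈ Q ⊓ (⊤ : Subgroup (SurfaceGroup g)).lowerCentralSeries 1 := by
    refine mem_inf.2 ⟨?_, mul_mem (hui₁ j) (inv_mem (huk₁ j))⟩
    have e : ui j * (uk j)⁻¹ = (ui j * PresentedGroup.of (j, cti j)) * (uk j * PresentedGroup.of (j, ctk j))⁻¹ := by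
      rw [hj]; group
    rw [e]
    exact mul_mem (hui₂ j) (inv_mem (huk₂ j))
  haveI : (πi.ker ⊔ πk.ker).Normal := inferInstance
  have hd2 : ui j * (uk j)⁻¹ ∈ ⁅πi.ker ⊔ πk.ker, (⊤ : Subgroup (SurfaceGroup g))⁆ ⊔
      (⊤ : Subgroup (SurfaceGroup g)).lowerCentralSeries 2 :=
    inf_lcs_le_commutator_sup Q _ hQ hQle hd
  have hkill : πi.ker ⊔ πk.ker ≤ (δ.comp πi).ker := by
    refine sup_le (fun x hx => ?_) (fun x hx => ?_)
    · rw [MonoidHom.mem_ker, MonoidHom.comp_apply, (MonoidHom.mem_ker).1 hx, map_one]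
    · rw [hδπ, MonoidHom.mem_ker, MonoidHom.comp_apply, (MonoidHom.mem_ker).1 hx, map_one]
  have hd3 : δ (πi (ui j)) * (δ (πk (uk j)))⁻¹ ∈ Γ₃ := by
    have h1 := map_commutator_sup_lcs_le (δ.comp πi) _ hkill (mem_map_of_mem _ hd2)
    have h2 : (δ.comp πi) (uk j) = δ (πk (uk j)) := by rw [hδπ, MonoidHom.comp_apply]
    rw [map_mul, map_inv, h2, MonoidHom.comp_apply] at h1
    exact h1
  -- both images are pair products supported on common handles
  have hδof : ∀ h, δ (FreeGroup.of h) = if cti h = ctk h then FreeGroup.of h else 1 := fun h => by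
    rw [hδ, FreeGroup.lift_apply_of]
  have hpp : ∀ (e : Fin g → Fin g → ℤ),
      δ (((List.finRange g).map (fun v => ((List.finRange g).map (fun w =>
        if v < w then ⁅(FreeGroup.of v : FreeGroup (Fin g)), FreeGroup.of w⁆ ^ (e v w)
        else (1 : FreeGroup (Fin g)))).prod)).prod) =
      ((List.finRange g).map (fun v => ((List.finRange g).map (fun w =>
        if v < w then ⁅(FreeGroup.of v : FreeGroup (Fin g)), FreeGroup.of w⁆ ^
          (if cti v = ctk v ∧ cti w = ctk w then e v w else 0)
        else (1 : FreeGroup (Fin g)))).prod)).prod := fun e => by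
    rw [pp_map]
    refine pp_congr _ _ _ _ fun v w _ => ?_
    rw [map_commutatorElement, hδof, hδof]
    by_cases hv : cti v = ctk v <;> by_cases hw : cti w = ctk w <;>
      simp [hv, hw]
  set ei : Fin g → Fin g → ℤ := fun v w =>
    if cti v = ctk v ∧ cti w = ctk w then (if cti j then (-1 : ℤ) else 1) * Di j v w else 0 with hei
  set ek : Fin g → Fin g → ℤ := fun v w =>
    if cti v = ctk v ∧ cti w = ctk w then (if ctk j then (-1 : ℤ) else 1) * Dk j v w else 0 with hek
  have hi : (QuotientGroup.mk' Γ₃) (δ (πi (ui j))) = QuotientGroup.mk' Γ₃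
      (((List.finRange g).map (fun v => ((List.finRange g).map (fun w =>
        if v < w then ⁅(FreeGroup.of v : FreeGroup (Fin g)), FreeGroup.of w⁆ ^ (ei v w)
        else (1 : FreeGroup (Fin g)))).prod)).prod) := by
    rw [QuotientGroup.mk'_apply, QuotientGroup.mk'_apply, ← mul_inv_mem_iff_quot, hei, ← hpp, ← map_inv,
      ← map_mul]
    exact map_lcs_mem δ (hDi j)
  have hk : (QuotientGroup.mk' Γ₃) (δ (πk (uk j))) = QuotientGroup.mk' Γ₃
      (((List.finRange g).map (fun v => ((List.finRange g).map (fun w =>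
        if v < w then ⁅(FreeGroup.of v : FreeGroup (Fin g)), FreeGroup.of w⁆ ^ (ek v w)
        else (1 : FreeGroup (Fin g)))).prod)).prod) := by
    rw [QuotientGroup.mk'_apply, QuotientGroup.mk'_apply, ← mul_inv_mem_iff_quot, hek, ← hpp, ← map_inv,
      ← map_mul]
    exact map_lcs_mem δ (hDk j)
  have hik : (QuotientGroup.mk' Γ₃) (δ (πi (ui j))) = (QuotientGroup.mk' Γ₃) (δ (πk (uk j))) := by
    rw [QuotientGroup.mk'_apply, QuotientGroup.mk'_apply, ← mul_inv_mem_iff_quot]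
    exact hd3
  rw [hik, hk] at hi
  have hsub := pp_sub_mem (fun v w => ⁅(FreeGroup.of v : FreeGroup (Fin g)), FreeGroup.of w⁆)
    (fun v w => ⟨_, _, rfl⟩) ek ei hi
  have hzero := hINJ g (fun v w => ek v w - ei v w) hsub
  -- read off the common coefficients
  have hvw : ∀ v w : Fin g, v < w → cti v = ctk v → cti w = ctk w → Di j v w = Dk j v w := by
    intro v w hlt hv hw
    have h0 := hzero v w hlt
    simp only [hei, hek, hv, hw, and_self, ite_true, hj] at h0
    have hs : (if ctk j then (-1 : ℤ) else 1) ≠ 0 := by split_ifs <;> decide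
    exact (Int.eq_of_mul_eq_mul_left hs (sub_eq_zero.1 h0)).symm
  rcases lt_trichotomy v w with hlt | rfl | hgt
  · exact hvw v w hlt hv hw
  · have h1 := hDi2 j v v
    have h2 := hDk2 j v v
    omega
  · have h1 := hvw w v hgt hw hv
    rw [hDi2 j w v, hDk2 j w v, h1]

end Reading

/-! ## Registered helper -/

/-- **Registered helper `helper_glueReading`** (sub-goal of the lead's skeleton for crux
stmt-SmoothPoincare4-14594): reading the level-one data of an honest kernel of `S_g` through the
erasing projection of a cut pattern, granted the READING lemma for `FreeGroup (Fin n)` (the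
landed `stub_magnusWittRead`, second conjunct). [folklore] -/
theorem helper_glueReading : (∀ (n : ℕ) (s : Fin n → ℤ) (η : Fin n → FreeGroup (Fin n)), (∀ j, s j = 1 ∨ s j = -1) → (∀ j, η j ∈ (⊤ : Subgroup (FreeGroup (Fin n))).lowerCentralSeries 1) → ((List.finRange n).map (fun j => ⁅(η j)⁻¹, FreeGroup.of j⁆ ^ (s j))).prod ∈ (⊤ : Subgroup (FreeGroup (Fin n))).lowerCentralSeries 3 → ∃ D : Fin n → Fin n → Fin n → ℤ, (∀ a b c, D b a c = -D a b c) ∧ (∀ a b c, D a c b = -D a b c) ∧ ∀ j, η j * (((List.finRange n).map (fun v => ((List.finRange n).map (fun w => if v < w then ⁅(FreeGroup.of v : FreeGroup (Fin n)), FreeGroup.of w⁆ ^ (s j * D j v w) else (1 : FreeGroup (Fin n)))).prod)).prod)⁻¹ ∈ (⊤ : Subgroup (FreeGroup (Fin n))).lowerCentralSeries 2) → ∀ (g : ℕ) (ct : Fin g → Bool) (π : Literature.Topology.FourManifolds.SurfaceGroup g →* FreeGroup (Fin g)), (∀ (h : Fin g) (b : Bool), π (PresentedGroup.of (h, b)) =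 if b = ct h then 1 else FreeGroup.of h) → ∀ (Q : Subgroup (Literature.Topology.FourManifolds.SurfaceGroup g)) (ρ : Literature.Topology.FourManifolds.SurfaceGroup g →* FreeGroup (Fin g)), Function.Surjective ρ → ρ.ker = Q → Q ≤ π.ker ⊔ (⊤ : Subgroup (Literature.Topology.FourManifolds.SurfaceGroup g)).lowerCentralSeries 1 → ∀ (u : Fin g → Literature.Topology.FourManifolds.SurfaceGroup g), (∀ h, u h ∈ (⊤ : Subgroup (Literature.Topology.FourManifolds.SurfaceGroup g)).lowerCentralSeries 1) → (∀ h, u h * PresentedGroup.of (h, ct h) ∈ Q) → ∃ D : Fin g → Fin g → Fin g → ℤ, (∀ a b c, D b a c = -D a b c) ∧ (∀ a b c, D a c b = -D a b c) ∧ ∀ j, π (u j) * (((List.finRange g).map (fun v => ((List.finRange g).map (fun w => if v < w then ⁅(FreeGroup.of v : FreeGroup (Fin g)), FreeGroup.of w⁆ ^ ((if ct j then (-1 : ℤ) else 1) * D j v w) else (1 : FreeGroup (Fin g)))).prod)).prod)⁻¹ ∈ (⊤ : Subgroup (FreeGroup (Fin g))).lowerCentralSeries 2 :=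
  fun hREAD _ ct π hπ Q ρ hρ hρQ hQ u hu₁ hu₂ => reading hREAD ct π hπ Q ρ hρ hρQ hQ u hu₁ hu₂

end Summit.SmoothPoincare4.SmoothPoincare4.Theorems.NilpotentShadowsStandard.SaturatedTorsorDescent
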